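import Summits.NavierStokesRegularity.NavierStokesRegularity.Theorems.PoloidalWindowDoorPoloidalWindowRigidityZShockVirialWindow
import HarnessLib

/-!
# Crux K2 `PoloidalWindowRigidity` (stmt-NavierStokesRegularity-19708), line `z_shock` — LOCALISED PATTERNS RELAX IN THE MEAN: without any
# periodicity, a horizontally localised solution of the hyperbolic autonomous height-evolution spends a vanishing fraction of heights away from
# the frozen state in every ball

`--supports stmt-NavierStokesRegularity-19708 --as helper` (leafhand-ns-poloidalwindowdoor-3 g11, cell decomp-ns, 2026-08-31).  Def-free; sequel of
`…ZShockVirialLaw` (p833222), `…ZShockPeriodicVirial` (p833370), `…ZShockBreatherBound` (p833514), `…ZShockNoLocalizedBreatherTools` (p833601),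
`…ZShockVirialWindow` (this seat).  **No stub and no summit is closed by this file; Navier–Stokes regularity is NOT proved here (rung 0).**

* `virial_window_le` — on a uniformly hyperbolic column (`−γhi ≤ G ≤ −γlo`, `γlo ≥ 0`, `Θ(w⋆) = 0`, `Θ' = (· − w⋆)G`), for a jointly smooth solution
  of the autonomous height-evolution with horizontal energy `∫(|u|² + (w−w⋆)²) ≤ B` at every height, every radius `a ≥ 0` and window `s₁ ≤ s₂`:

    `∫_{s₁}^{s₂}∫ χ_a γlo (w − w⋆)² ≤ (a+1)·B + L(a+1)·∫_{s₁}^{s₂}∫ (χ_{a+1} − χ_{a−1})·(³⁄₂|u|² + (γhi/2)(w − w⋆)²)`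

  (`L` the slope bound of the cutoff profile): boundary terms of size `radius × energy`, shell term as in the breather bound.
* ★ `localized_defect_small_on_long_windows` — **RELAXATION IN THE MEAN.**  Same setting, `γlo > 0`: for every radius `a' ≥ 0` and `ε > 0` there is
  `T₀ > 0` such that for EVERY height window of length `T ≥ T₀`, wherever it starts,

    `∫_{s₁}^{s₁+T} ∫ χ_{a'}(y)·γlo (w − w⋆)²(s, y) dy ds ≤ ε·T`.

  Thus the defect inside any fixed ball has zero upper Banach density along the heights: a horizontally localised pattern cannot RECUR in a
  ball — no breathers (periodic case, `…ZShockNoLocalizedBreather`), no almost-periodic / quasi-periodic localised patterns, no localised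
  pattern «active» on a positive fraction of heights; it relaxes to the frozen state `w⋆` in Cesàro mean.  Only HYPERBOLICITY is used (for the
  linear column this is local-energy decay of finite-energy waves), so the statement holds on the thick and the thin column alike.

Reading for the line (R3 inhabitant census, card `Lines/z_shock.md` §Instrument row, I3 «bounded RECURRENT 2-D autonomous thick profile»): a
kinematic inhabitant of the autonomous hyperbolic column that is recurrent in some ball must RADIATE — infinite horizontal energy about every
level at some height (the rotating Bessel witness of `…ZShockRotatingProfileLinearWitness` does: amplitude `≍ r^{-1/2}`).  Class profiles are never
vertically periodic (`…VerticalPeriod`, `…Periodic`); these statements concern the kinematic system of R3, whose inhabitants would refute the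
line's mechanism, not the crux. [folklore]
-/

noncomputable section

namespace Summit.NavierStokesRegularity.NavierStokesRegularity.Theorems.PoloidalWindowDoorPoloidalWindowRigidityZShockLocalizedRelaxation

-- the summit and its single sub-problem share the name (CONVENTIONS §1)
set_option linter.dupNamespace false

open Set Filter Topology Function MeasureTheory Metric
open scoped ContDiff
open Summit.NavierStokesRegularity.NavierStokesRegularity.Theorems.PoloidalWindowDoorPoloidalWindowRigidityZShockVirialLaw
open Summit.NavierStokesRegularity.NavierStokesRegularity.Theorems.PoloidalWindowDoorPoloidalWindowRigidityZShockLocalEnergyCutoff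
open Summit.NavierStokesRegularity.NavierStokesRegularity.Theorems.PoloidalWindowDoorPoloidalWindowRigidityZShockLocalEnergy
open Summit.NavierStokesRegularity.NavierStokesRegularity.Theorems.PoloidalWindowDoorPoloidalWindowRigidityZShockPeriodicVirial
open Summit.NavierStokesRegularity.NavierStokesRegularity.Theorems.PoloidalWindowDoorPoloidalWindowRigidityZShockBreatherBound
open Summit.NavierStokesRegularity.NavierStokesRegularity.Theorems.PoloidalWindowDoorPoloidalWindowRigidityZShockNoLocalizedBreatherTools
open Summit.NavierStokesRegularity.NavierStokesRegularity.Theorems.PoloidalWindowDoorPoloidalWindowRigidityZShockVirialWindow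

variable {u : Fin 2 → ℝ → EuclideanSpace ℝ (Fin 2) → ℝ} {w : ℝ → EuclideanSpace ℝ (Fin 2) → ℝ} {G Θ : ℝ → ℝ}
  {wstar γlo γhi B L : ℝ}

/-- **The virial inequality on a height window** (hypotheses in the module docstring). [folklore] -/
theorem virial_window_le (hu : ∀ i, ContDiff ℝ ∞ (uncurry (u i))) (hw : ContDiff ℝ ∞ (uncurry w))
    (hΘs : ContDiff ℝ ∞ Θ) (hΘ : ∀ r, HasDerivAt Θ ((r - wstar) * G r) r) (hΘ0 : Θ wstar = 0)
    (hγlo : 0 ≤ γlo) (hGlo : ∀ r, G r ≤ -γlo) (hGhi : ∀ r, -γhi ≤ G r)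
    (hus : ∀ i s y, HasDerivAt (fun s' => u i s' y) (G (w s y) * fderiv ℝ (w s) y (EuclideanSpace.single i 1)) s)
    (hws : ∀ s y, HasDerivAt (fun s' => w s' y)
      (-(fderiv ℝ (u 0 s) y (EuclideanSpace.single 0 1) + fderiv ℝ (u 1 s) y (EuclideanSpace.single 1 1))) s)
    (hpol : ∀ s y, fderiv ℝ (u 0 s) y (EuclideanSpace.single 1 1) = fderiv ℝ (u 1 s) y (EuclideanSpace.single 0 1))
    (hint : ∀ s, Integrable fun y => u 0 s y ^ 2 + u 1 s y ^ 2 + (w s y - wstar) ^ 2)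
    (hB : ∀ s, ∫ y, (u 0 s y ^ 2 + u 1 s y ^ 2 + (w s y - wstar) ^ 2) ≤ B)
    (hL0 : 0 ≤ L) (hL : ∀ b t : ℝ, |deriv (fun v : ℝ => Real.smoothTransition (b - v)) t| ≤ L)
    {a : ℝ} (ha : 0 ≤ a) {s₁ s₂ : ℝ} (hs : s₁ ≤ s₂) :
    ∫ s in s₁..s₂, ∫ y : EuclideanSpace ℝ (Fin 2), Real.smoothTransition (a + 1 - √(1 + ‖y‖ ^ 2)) * (γlo * (w s y - wstar) ^ 2) ≤
      (a + 1) * B + L * (a + 1) * ∫ s in s₁..s₂, ∫ y : EuclideanSpace ℝ (Fin 2),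
        (Real.smoothTransition (a + 2 - √(1 + ‖y‖ ^ 2)) - Real.smoothTransition (a - √(1 + ‖y‖ ^ 2))) *
          ((3 / 2) * (u 0 s y ^ 2 + u 1 s y ^ 2) + (γhi / 2) * (w s y - wstar) ^ 2) := by
  have hG0 : ∀ r, G r ≤ 0 := fun r => (hGlo r).trans (by linarith)
  have hγhi : 0 ≤ γhi := by linarith [hGlo 0, hGhi 0]
  -- densities and their regularity
  set K : ℝ → EuclideanSpace ℝ (Fin 2) → ℝ := fun s y =>
    (3 / 2) * (u 0 s y ^ 2 + u 1 s y ^ 2) + (γhi / 2) * (w s y - wstar) ^ 2 with hK_def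
  set Dd : ℝ → EuclideanSpace ℝ (Fin 2) → ℝ := fun s y => γlo * (w s y - wstar) ^ 2 with hDd_def
  have hu2 : ContDiff ℝ ∞ (uncurry fun s (y : EuclideanSpace ℝ (Fin 2)) => u 0 s y ^ 2 + u 1 s y ^ 2) :=
    ((hu 0).pow 2).add ((hu 1).pow 2)
  have hd2 : ContDiff ℝ ∞ (uncurry fun s (y : EuclideanSpace ℝ (Fin 2)) => (w s y - wstar) ^ 2) :=
    (hw.sub contDiff_const).pow 2
  have hΘw : ContDiff ℝ ∞ (uncurry fun s (y : EuclideanSpace ℝ (Fin 2)) => Θ (w s y)) := hΘs.comp hw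
  have hKc : Continuous (uncurry K) := (continuous_const.mul hu2.continuous).add (continuous_const.mul hd2.continuous)
  have hDdc : Continuous (uncurry Dd) := continuous_const.mul hd2.continuous
  have hSgc : Continuous (uncurry fun s (y : EuclideanSpace ℝ (Fin 2)) => -2 * Θ (w s y)) := continuous_const.mul hΘw.continuous
  have hK0 : ∀ s y, 0 ≤ K s y := fun s y => by simp only [hK_def]; positivity
  have hDd0 : ∀ s y, 0 ≤ Dd s y := fun s y => by simp only [hDd_def]; positivity
  have he : ContDiff ℝ ∞ (uncurry fun s (y : EuclideanSpace ℝ (Fin 2)) => (y 0 * u 0 s y + y 1 * u 1 s y) * (w s y - wstar)) :=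
    smooth_moment hu hw wstar
  have hf : ∀ i, ContDiff ℝ ∞ (uncurry fun s (y : EuclideanSpace ℝ (Fin 2)) =>
      (y 0 * u 0 s y + y 1 * u 1 s y) * u i s y - (1 / 2) * (u 0 s y ^ 2 + u 1 s y ^ 2) * y i - Θ (w s y) * y i) :=
    fun i => smooth_flux hu hw hΘs i
  -- the identity on the window, cleaned of the `c = 0` bookkeeping
  have hid := virial_window_identity hu hw hΘs hΘ hus hws hpol a s₁ s₂
  simp only [zero_mul, add_zero, zero_add] at hid
  -- (1) defect ≤ bulk, pointwise in the height
  have hχc := continuous_cutoff a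
  have hχ0 := cutoff_zero_of_lt a
  have h1 : ∫ s in s₁..s₂, ∫ y : EuclideanSpace ℝ (Fin 2), Real.smoothTransition (a + 1 - √(1 + ‖y‖ ^ 2)) * Dd s y ≤
      ∫ s in s₁..s₂, ∫ y : EuclideanSpace ℝ (Fin 2), Real.smoothTransition (a + 1 - √(1 + ‖y‖ ^ 2)) * (-2 * Θ (w s y)) := by
    refine intervalIntegral.integral_mono_on hs ((continuous_weighted hDdc hχc hχ0).intervalIntegrable _ _)
      ((continuous_weighted hSgc hχc hχ0).intervalIntegrable _ _) fun s _ => ?_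
    refine integral_mono (integrable_weighted hDdc hχc hχ0 s) (integrable_weighted hSgc hχc hχ0 s) fun y => ?_
    exact mul_le_mul_of_nonneg_left (bulk_bounds hΘ hΘ0 hGlo hGhi (w s y)).1 (Real.smoothTransition.nonneg _)
  -- (2) the boundary terms
  have hB0 : 0 ≤ B := (integral_nonneg fun y => by positivity).trans (hB s₁)
  have hM : ∀ s, |∫ y : EuclideanSpace ℝ (Fin 2), Real.smoothTransition (a + 1 - √(1 + ‖y‖ ^ 2)) *
      ((y 0 * u 0 s y + y 1 * u 1 s y) * (w s y - wstar))| ≤ (a + 1) / 2 * B := fun s =>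
    (abs_moment_le hu hw ha s (hint s)).trans (mul_le_mul_of_nonneg_left (hB s) (by positivity))
  -- (3) the shell term: `|∫ T| ≤ ∫ R ≤ L (a+1) ∫ ρ K`
  have hσc : Continuous fun y : EuclideanSpace ℝ (Fin 2) =>
      |deriv (fun v : ℝ => Real.smoothTransition (a + 1 - v)) (√(1 + ‖y‖ ^ 2))| * √(1 + ‖y‖ ^ 2) := by
    have h := continuous_deriv_cutoff (n := 2) a 0 0
    simp only [mul_zero, add_zero] at h
    exact h.abs.mul (contDiff_bracket (k := 0)).continuous
  have hσ0 : ∀ y : EuclideanSpace ℝ (Fin 2), a + 1 < ‖y‖ →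
      |deriv (fun v : ℝ => Real.smoothTransition (a + 1 - v)) (√(1 + ‖y‖ ^ 2))| * √(1 + ‖y‖ ^ 2) = 0 := by
    intro y hy
    rw [deriv_profile_eq_zero (by linarith [norm_le_bracket y]), abs_zero, zero_mul]
  have hρc : Continuous fun y : EuclideanSpace ℝ (Fin 2) =>
      Real.smoothTransition (a + 2 - √(1 + ‖y‖ ^ 2)) - Real.smoothTransition (a - √(1 + ‖y‖ ^ 2)) := by
    have h1 := continuous_cutoff (a + 1)
    have h2 := continuous_cutoff (a - 1)
    simp only [sub_add_cancel] at h2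
    exact (h1.congr fun y => by ring_nf).sub h2
  have hρ0 : ∀ y : EuclideanSpace ℝ (Fin 2), a + 2 < ‖y‖ →
      Real.smoothTransition (a + 2 - √(1 + ‖y‖ ^ 2)) - Real.smoothTransition (a - √(1 + ‖y‖ ^ 2)) = 0 := by
    intro y hy
    have hb := norm_le_bracket y
    rw [Real.smoothTransition.zero_of_nonpos (by linarith), Real.smoothTransition.zero_of_nonpos (by linarith), sub_zero]
  -- the raw `T`-integrand: continuous, compactly supported, dominated
  have hTic : Continuous (uncurry fun s (y : EuclideanSpace ℝ (Fin 2)) =>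
      deriv (fun v : ℝ => Real.smoothTransition (a + 1 - v)) (√(1 + ‖y‖ ^ 2)) / √(1 + ‖y‖ ^ 2) *
        ∑ i : Fin 2, y i * ((y 0 * u 0 s y + y 1 * u 1 s y) * u i s y
          - (1 / 2) * (u 0 s y ^ 2 + u 1 s y ^ 2) * y i - Θ (w s y) * y i)) := by
    have hd : Continuous fun p : ℝ × EuclideanSpace ℝ (Fin 2) =>
        deriv (fun v : ℝ => Real.smoothTransition (a + 1 - v)) (√(1 + ‖p.2‖ ^ 2)) / √(1 + ‖p.2‖ ^ 2) := by
      have h := continuous_deriv_cutoff (n := 2) a 0 0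
      simp only [mul_zero, add_zero] at h
      exact (h.comp continuous_snd).div ((contDiff_bracket (k := 0)).continuous.comp continuous_snd) fun p => (bracket_pos p.2).ne'
    exact hd.mul (continuous_finsetSum _ fun i _ => (contDiff_snd_coord i).continuous.mul (hf i).continuous)
  have hTc : Continuous fun s => ∫ y : EuclideanSpace ℝ (Fin 2),
      deriv (fun v : ℝ => Real.smoothTransition (a + 1 - v)) (√(1 + ‖y‖ ^ 2)) / √(1 + ‖y‖ ^ 2) *
        ∑ i : Fin 2, y i * ((y 0 * u 0 s y + y 1 * u 1 s y) * u i s y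
          - (1 / 2) * (u 0 s y ^ 2 + u 1 s y ^ 2) * y i - Θ (w s y) * y i) := by
    have h := Literature.Analysis.FluidPDE.continuousOn_integral_of_support_subset
      (μ := (volume : Measure (EuclideanSpace ℝ (Fin 2)))) (S := univ)
      (Φ := fun s (y : EuclideanSpace ℝ (Fin 2)) =>
        deriv (fun v : ℝ => Real.smoothTransition (a + 1 - v)) (√(1 + ‖y‖ ^ 2)) / √(1 + ‖y‖ ^ 2) *
          ∑ i : Fin 2, y i * ((y 0 * u 0 s y + y 1 * u 1 s y) * u i s y
            - (1 / 2) * (u 0 s y ^ 2 + u 1 s y ^ 2) * y i - Θ (w s y) * y i))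
      (isCompact_closedBall (0 : EuclideanSpace ℝ (Fin 2)) (a + 1)) hTic.continuousOn (fun s _ y hy => by
        rw [mem_closedBall, dist_zero_right, not_le] at hy
        show deriv (fun v : ℝ => Real.smoothTransition (a + 1 - v)) (√(1 + ‖y‖ ^ 2)) / √(1 + ‖y‖ ^ 2) *
          ∑ i : Fin 2, y i * ((y 0 * u 0 s y + y 1 * u 1 s y) * u i s y
            - (1 / 2) * (u 0 s y ^ 2 + u 1 s y ^ 2) * y i - Θ (w s y) * y i) = 0
        rw [deriv_profile_eq_zero (by linarith [norm_le_bracket y])]; simp)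
    exact continuousOn_univ.1 h
  have hRle : ∀ s, |∫ y : EuclideanSpace ℝ (Fin 2),
      deriv (fun v : ℝ => Real.smoothTransition (a + 1 - v)) (√(1 + ‖y‖ ^ 2)) / √(1 + ‖y‖ ^ 2) *
        ∑ i : Fin 2, y i * ((y 0 * u 0 s y + y 1 * u 1 s y) * u i s y
          - (1 / 2) * (u 0 s y ^ 2 + u 1 s y ^ 2) * y i - Θ (w s y) * y i)| ≤
      L * (a + 1) * ∫ y, (Real.smoothTransition (a + 2 - √(1 + ‖y‖ ^ 2)) - Real.smoothTransition (a - √(1 + ‖y‖ ^ 2))) * K s y := by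
    intro s
    rw [← integral_const_mul]
    refine (abs_integral_le_integral_abs).trans (integral_mono ?_ ((integrable_weighted hKc hρc hρ0 s).const_mul _) fun y => ?_)
    · exact ((hTic.comp (Continuous.prodMk_right s)).abs).integrable_of_hasCompactSupport (by
        refine HasCompactSupport.intro (isCompact_closedBall (0 : EuclideanSpace ℝ (Fin 2)) (a + 1)) fun y hy => ?_
        rw [mem_closedBall, dist_zero_right, not_le] at hy
        show |deriv (fun v : ℝ => Real.smoothTransition (a + 1 - v)) (√(1 + ‖y‖ ^ 2)) / √(1 + ‖y‖ ^ 2) *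
          ∑ i : Fin 2, y i * ((y 0 * u 0 s y + y 1 * u 1 s y) * u i s y
            - (1 / 2) * (u 0 s y ^ 2 + u 1 s y ^ 2) * y i - Θ (w s y) * y i)| = 0
        rw [deriv_profile_eq_zero (by linarith [norm_le_bracket y])]; simp)
    · have hsh := abs_shell_integrand_le (u := u) (w := w) hΘ hΘ0 hG0 hGhi
        (deriv (fun v : ℝ => Real.smoothTransition (a + 1 - v)) (√(1 + ‖y‖ ^ 2))) 0 s y
      simp only [mul_zero, zero_mul, zero_add] at hsh
      have hdom := abs_deriv_profile_mul_le hL0 hL ha (bracket_pos y).le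
      have hk := hK0 s y
      calc |deriv (fun v : ℝ => Real.smoothTransition (a + 1 - v)) (√(1 + ‖y‖ ^ 2)) / √(1 + ‖y‖ ^ 2) *
            ∑ i : Fin 2, y i * ((y 0 * u 0 s y + y 1 * u 1 s y) * u i s y
              - (1 / 2) * (u 0 s y ^ 2 + u 1 s y ^ 2) * y i - Θ (w s y) * y i)|
          ≤ |deriv (fun v : ℝ => Real.smoothTransition (a + 1 - v)) (√(1 + ‖y‖ ^ 2))| * (√(1 + ‖y‖ ^ 2) * K s y) := hsh
        _ = (|deriv (fun v : ℝ => Real.smoothTransition (a + 1 - v)) (√(1 + ‖y‖ ^ 2))| * √(1 + ‖y‖ ^ 2)) * K s y := by ring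
        _ ≤ (L * (a + 1) * (Real.smoothTransition (a + 2 - √(1 + ‖y‖ ^ 2)) - Real.smoothTransition (a - √(1 + ‖y‖ ^ 2)))) * K s y :=
            mul_le_mul_of_nonneg_right hdom hk
        _ = L * (a + 1) * ((Real.smoothTransition (a + 2 - √(1 + ‖y‖ ^ 2)) - Real.smoothTransition (a - √(1 + ‖y‖ ^ 2))) * K s y) := by
            ring
  have hHc : Continuous fun s => ∫ y, (Real.smoothTransition (a + 2 - √(1 + ‖y‖ ^ 2)) -
      Real.smoothTransition (a - √(1 + ‖y‖ ^ 2))) * K s y := continuous_weighted hKc hρc hρ0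
  have h3 : |∫ s in s₁..s₂, ∫ y : EuclideanSpace ℝ (Fin 2),
      deriv (fun v : ℝ => Real.smoothTransition (a + 1 - v)) (√(1 + ‖y‖ ^ 2)) / √(1 + ‖y‖ ^ 2) *
        ∑ i : Fin 2, y i * ((y 0 * u 0 s y + y 1 * u 1 s y) * u i s y
          - (1 / 2) * (u 0 s y ^ 2 + u 1 s y ^ 2) * y i - Θ (w s y) * y i)| ≤
      L * (a + 1) * ∫ s in s₁..s₂, ∫ y, (Real.smoothTransition (a + 2 - √(1 + ‖y‖ ^ 2)) -
        Real.smoothTransition (a - √(1 + ‖y‖ ^ 2))) * K s y := by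
    rw [← intervalIntegral.integral_const_mul]
    exact (intervalIntegral.abs_integral_le_integral_abs hs).trans
      (intervalIntegral.integral_mono_on hs (hTc.abs.intervalIntegrable _ _) ((hHc.const_mul _).intervalIntegrable _ _)
        fun s _ => hRle s)
  -- assemble
  have hM1 := hM s₁
  have hM2 := hM s₂
  have hfin : ∫ s in s₁..s₂, ∫ y : EuclideanSpace ℝ (Fin 2), Real.smoothTransition (a + 1 - √(1 + ‖y‖ ^ 2)) * (-2 * Θ (w s y)) ≤
      (a + 1) * B + L * (a + 1) * ∫ s in s₁..s₂, ∫ y, (Real.smoothTransition (a + 2 - √(1 + ‖y‖ ^ 2)) -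
        Real.smoothTransition (a - √(1 + ‖y‖ ^ 2))) * K s y := by
    rw [hid]
    have e1 := abs_le.1 hM1
    have e2 := abs_le.1 hM2
    have e3 := abs_le.1 h3
    nlinarith [e1.1, e1.2, e2.1, e2.2, e3.1, e3.2]
  exact h1.trans hfin


/-- ★ **Relaxation in the mean of localised patterns** (hypotheses in the module docstring): for every radius `a' ≥ 0` and `ε > 0` there is
`T₀ > 0` with `∫_{s₁}^{s₁+T}∫ χ_{a'} γlo (w − w⋆)² ≤ ε·T` for all `s₁` and all `T ≥ T₀`. [folklore] -/
theorem localized_defect_small_on_long_windows (hu : ∀ i, ContDiff ℝ ∞ (uncurry (u i))) (hw : ContDiff ℝ ∞ (uncurry w))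
    (hΘs : ContDiff ℝ ∞ Θ) (hΘ : ∀ r, HasDerivAt Θ ((r - wstar) * G r) r) (hΘ0 : Θ wstar = 0)
    (hγlo : 0 < γlo) (hGlo : ∀ r, G r ≤ -γlo) (hGhi : ∀ r, -γhi ≤ G r)
    (hus : ∀ i s y, HasDerivAt (fun s' => u i s' y) (G (w s y) * fderiv ℝ (w s) y (EuclideanSpace.single i 1)) s)
    (hws : ∀ s y, HasDerivAt (fun s' => w s' y)
      (-(fderiv ℝ (u 0 s) y (EuclideanSpace.single 0 1) + fderiv ℝ (u 1 s) y (EuclideanSpace.single 1 1))) s)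
    (hpol : ∀ s y, fderiv ℝ (u 0 s) y (EuclideanSpace.single 1 1) = fderiv ℝ (u 1 s) y (EuclideanSpace.single 0 1))
    (hint : ∀ s, Integrable fun y => u 0 s y ^ 2 + u 1 s y ^ 2 + (w s y - wstar) ^ 2)
    (hB : ∀ s, ∫ y, (u 0 s y ^ 2 + u 1 s y ^ 2 + (w s y - wstar) ^ 2) ≤ B)
    {a' : ℝ} (ha' : 0 ≤ a') {ε : ℝ} (hε : 0 < ε) :
    ∃ T₀ : ℝ, 0 < T₀ ∧ ∀ s₁ T : ℝ, T₀ ≤ T →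
      ∫ s in s₁..s₁ + T, ∫ y : EuclideanSpace ℝ (Fin 2),
          Real.smoothTransition (a' + 1 - √(1 + ‖y‖ ^ 2)) * (γlo * (w s y - wstar) ^ 2) ≤ ε * T := by
  have hγhi : 0 ≤ γhi := by linarith [hGlo 0, hGhi 0]
  have hB0 : 0 ≤ B := (integral_nonneg fun y => by positivity).trans (hB 0)
  obtain ⟨L, hL0, hL⟩ := exists_deriv_profile_bound
  -- densities
  set K : ℝ → EuclideanSpace ℝ (Fin 2) → ℝ := fun s y =>
    (3 / 2) * (u 0 s y ^ 2 + u 1 s y ^ 2) + (γhi / 2) * (w s y - wstar) ^ 2 with hK_def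
  set Dd : ℝ → EuclideanSpace ℝ (Fin 2) → ℝ := fun s y => γlo * (w s y - wstar) ^ 2 with hDd_def
  have hu2 : ContDiff ℝ ∞ (uncurry fun s (y : EuclideanSpace ℝ (Fin 2)) => u 0 s y ^ 2 + u 1 s y ^ 2) :=
    ((hu 0).pow 2).add ((hu 1).pow 2)
  have hd2 : ContDiff ℝ ∞ (uncurry fun s (y : EuclideanSpace ℝ (Fin 2)) => (w s y - wstar) ^ 2) :=
    (hw.sub contDiff_const).pow 2
  have hKc : Continuous (uncurry K) := (continuous_const.mul hu2.continuous).add (continuous_const.mul hd2.continuous)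
  have hDdc : Continuous (uncurry Dd) := continuous_const.mul hd2.continuous
  have hK0 : ∀ s y, 0 ≤ K s y := fun s y => by simp only [hK_def]; positivity
  have hDd0 : ∀ s y, 0 ≤ Dd s y := fun s y => by simp only [hDd_def]; positivity
  have hKle : ∀ s y, K s y ≤ (3 / 2 + γhi / 2) * (u 0 s y ^ 2 + u 1 s y ^ 2 + (w s y - wstar) ^ 2) := by
    intro s y
    simp only [hK_def]
    nlinarith [sq_nonneg (u 0 s y), sq_nonneg (u 1 s y), sq_nonneg (w s y - wstar)]
  have hKint : ∀ s, Integrable (K s) := fun s =>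
    (((hint s).const_mul (3 / 2 + γhi / 2)).mono' (hKc.comp (Continuous.prodMk_right s)).aestronglyMeasurable
      (Eventually.of_forall fun y => by
        rw [Real.norm_eq_abs, abs_of_nonneg (hK0 s y)]; exact hKle s y))
  have hKB : ∀ s, ∫ y, K s y ≤ (3 / 2 + γhi / 2) * B := fun s =>
    calc ∫ y, K s y ≤ ∫ y, (3 / 2 + γhi / 2) * (u 0 s y ^ 2 + u 1 s y ^ 2 + (w s y - wstar) ^ 2) :=
          integral_mono (hKint s) ((hint s).const_mul _) (hKle s)
      _ = (3 / 2 + γhi / 2) * ∫ y, (u 0 s y ^ 2 + u 1 s y ^ 2 + (w s y - wstar) ^ 2) := integral_const_mul _ _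
      _ ≤ (3 / 2 + γhi / 2) * B := mul_le_mul_of_nonneg_left (hB s) (by positivity)
  -- the uniform selection bound and the window length
  set ε' : ℝ := ε / (2 * (L + 1)) with hε'
  have hε'0 : 0 < ε' := by positivity
  obtain ⟨N₀, hN₀⟩ := exists_index_bound ((3 / 2 + γhi / 2) * B) ha' hε'0
  set A : ℝ := a' + 2 * N₀ + 2 with hA
  have hA0 : 0 < A := by positivity
  refine ⟨2 * A * (B + 1) / ε + 1, by positivity, fun s₁ T hT => ?_⟩
  have hT0 : 0 < T := lt_of_lt_of_le (by positivity) hT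
  -- the cutoffs along the radii `a' + 2k + 1`
  set c : ℕ → EuclideanSpace ℝ (Fin 2) → ℝ := fun k y => Real.smoothTransition (a' + 2 * k + 1 - √(1 + ‖y‖ ^ 2)) with hc_def
  have hcc : ∀ k, Continuous (c k) := fun k => by
    have := continuous_cutoff (a' + 2 * k)
    simpa [hc_def] using this
  have hc0 : ∀ (k : ℕ) (y : EuclideanSpace ℝ (Fin 2)), a' + 2 * (k : ℝ) + 1 < ‖y‖ → c k y = 0 := fun k y hy =>
    Real.smoothTransition.zero_of_nonpos (by linarith [norm_le_bracket y])
  have hcd : ∀ k, Continuous fun y => c (k + 1) y - c k y := fun k => (hcc (k + 1)).sub (hcc k)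
  have hcd0 : ∀ (k : ℕ) (y : EuclideanSpace ℝ (Fin 2)), a' + 2 * (k : ℝ) + 3 < ‖y‖ → c (k + 1) y - c k y = 0 := by
    intro k y hy
    rw [hc0 (k + 1) y (by push_cast; linarith), hc0 k y (by linarith), sub_zero]
  -- shell energies on the window, normalised by its length
  set h : ℕ → ℝ := fun k => (1 / T) * ∫ s in s₁..s₁ + T, ∫ y, (c (k + 1) y - c k y) * K s y with hh_def
  have hhc : ∀ k, Continuous fun s => ∫ y, (c (k + 1) y - c k y) * K s y := fun k => continuous_weighted hKc (hcd k) (hcd0 k)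
  have hh0 : ∀ k, 0 ≤ h k := fun k =>
    mul_nonneg (by positivity) (intervalIntegral.integral_nonneg (by linarith) fun s _ => integral_nonneg fun y =>
      mul_nonneg (sub_nonneg.2 (Real.smoothTransition.monotone (by push_cast; linarith))) (hK0 s y))
  have hsum : ∀ N, ∑ k ∈ Finset.range N, h k ≤ (3 / 2 + γhi / 2) * B := by
    intro N
    have hlin : ∑ k ∈ Finset.range N, h k = (1 / T) * ∫ s in s₁..s₁ + T, ∫ y, (c N y - c 0 y) * K s y := by
      simp only [hh_def]
      rw [← Finset.mul_sum, ← intervalIntegral.integral_finsetSum fun k _ => (hhc k).intervalIntegrable _ _]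
      congr 1
      refine intervalIntegral.integral_congr fun s _ => ?_
      show ∑ k ∈ Finset.range N, ∫ y, (c (k + 1) y - c k y) * K s y = ∫ y, (c N y - c 0 y) * K s y
      rw [← integral_finsetSum _ fun k _ => integrable_weighted hKc (hcd k) (hcd0 k) s]
      refine integral_congr_ae (Eventually.of_forall fun y => ?_)
      show ∑ k ∈ Finset.range N, (c (k + 1) y - c k y) * K s y = (c N y - c 0 y) * K s y
      rw [← Finset.sum_mul, Finset.sum_range_sub (fun k => c k y)]
    rw [hlin]
    have hNc : Continuous fun s => ∫ y, (c N y - c 0 y) * K s y :=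
      continuous_weighted hKc ((hcc N).sub (hcc 0)) (R := a' + 2 * N + 1) fun y hy => by
        show c N y - c 0 y = 0
        rw [hc0 N y hy, hc0 0 y (by push_cast; linarith), sub_zero]
    have hwin : ∫ s in s₁..s₁ + T, ∫ y, (c N y - c 0 y) * K s y ≤ (3 / 2 + γhi / 2) * B * T := by
      calc ∫ s in s₁..s₁ + T, ∫ y, (c N y - c 0 y) * K s y
          ≤ ∫ s in s₁..s₁ + T, (3 / 2 + γhi / 2) * B := by
            refine intervalIntegral.integral_mono_on (by linarith) (hNc.intervalIntegrable _ _) (by simp) fun s _ => ?_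
            calc ∫ y, (c N y - c 0 y) * K s y ≤ ∫ y, K s y := by
                  refine integral_mono (integrable_weighted hKc ((hcc N).sub (hcc 0)) (R := a' + 2 * N + 1)
                    (fun y hy => by
                      show c N y - c 0 y = 0
                      rw [hc0 N y hy, hc0 0 y (by push_cast; linarith), sub_zero]) s) (hKint s) fun y => ?_
                  have h1 : c N y - c 0 y ≤ 1 := by
                    have := Real.smoothTransition.le_one (a' + 2 * N + 1 - √(1 + ‖y‖ ^ 2))
                    have := Real.smoothTransition.nonneg (a' + 2 * (0 : ℕ) + 1 - √(1 + ‖y‖ ^ 2))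
                    simp only [hc_def]; linarith
                  calc (c N y - c 0 y) * K s y ≤ 1 * K s y := mul_le_mul_of_nonneg_right h1 (hK0 s y)
                    _ = K s y := one_mul _
              _ ≤ (3 / 2 + γhi / 2) * B := hKB s
        _ = (3 / 2 + γhi / 2) * B * T := by rw [intervalIntegral.integral_const, smul_eq_mul]; ring
    calc (1 / T) * ∫ s in s₁..s₁ + T, ∫ y, (c N y - c 0 y) * K s y ≤ (1 / T) * ((3 / 2 + γhi / 2) * B * T) :=
          mul_le_mul_of_nonneg_left hwin (by positivity)
      _ = (3 / 2 + γhi / 2) * B := by field_simp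
  -- select a thin shell with bounded index
  obtain ⟨k, hkN, hk⟩ := hN₀ h hh0 hsum
  have hak : 0 ≤ a' + 2 * k + 1 := by positivity
  have hakA : a' + 2 * k + 1 + 1 ≤ A := by
    have : (k : ℝ) ≤ N₀ := by exact_mod_cast hkN.le
    simp only [hA]; linarith
  -- monotonicity in the radius and the window inequality at the selected radius
  have hJc : ∀ a, Continuous fun s => ∫ y, Real.smoothTransition (a + 1 - √(1 + ‖y‖ ^ 2)) * Dd s y := fun a =>
    continuous_weighted hDdc (continuous_cutoff a) (cutoff_zero_of_lt a)
  have hmono : ∫ s in s₁..s₁ + T, ∫ y, Real.smoothTransition (a' + 1 - √(1 + ‖y‖ ^ 2)) * Dd s y ≤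
      ∫ s in s₁..s₁ + T, ∫ y, Real.smoothTransition (a' + 2 * k + 1 + 1 - √(1 + ‖y‖ ^ 2)) * Dd s y := by
    refine intervalIntegral.integral_mono_on (by linarith) ((hJc a').intervalIntegrable _ _)
      ((hJc (a' + 2 * k + 1)).intervalIntegrable _ _) fun s _ => ?_
    refine integral_mono (integrable_weighted hDdc (continuous_cutoff a') (cutoff_zero_of_lt a') s)
      (integrable_weighted hDdc (continuous_cutoff (a' + 2 * k + 1)) (cutoff_zero_of_lt (a' + 2 * k + 1)) s) fun y => ?_
    exact mul_le_mul_of_nonneg_right (Real.smoothTransition.monotone (by linarith [hak])) (hDd0 s y)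
  have hwle := virial_window_le hu hw hΘs hΘ hΘ0 hγlo.le hGlo hGhi hus hws hpol hint hB hL0 hL hak
    (show s₁ ≤ s₁ + T by linarith)
  -- identify the shell term with `T · h k`
  have h3 : (∫ s in s₁..s₁ + T, ∫ y, (Real.smoothTransition (a' + 2 * k + 1 + 2 - √(1 + ‖y‖ ^ 2)) -
      Real.smoothTransition (a' + 2 * k + 1 - √(1 + ‖y‖ ^ 2))) *
        ((3 / 2) * (u 0 s y ^ 2 + u 1 s y ^ 2) + (γhi / 2) * (w s y - wstar) ^ 2)) = T * h k := by
    have e1 : ∀ y : EuclideanSpace ℝ (Fin 2),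
        a' + 2 * (k : ℝ) + 1 + 2 - √(1 + ‖y‖ ^ 2) = a' + 2 * ((k + 1 : ℕ) : ℝ) + 1 - √(1 + ‖y‖ ^ 2) := fun y => by
      push_cast; ring
    simp only [hh_def, hc_def, hK_def, e1]
    field_simp
  rw [h3] at hwle
  -- the two halves of `ε T`
  have hhalf1 : (a' + 2 * k + 1 + 1) * B ≤ ε * T / 2 := by
    have h1 : (a' + 2 * k + 1 + 1) * B ≤ A * B := mul_le_mul_of_nonneg_right hakA hB0
    have h2 : A * (B + 1) ≤ ε * T / 2 := by
      have : 2 * A * (B + 1) / ε ≤ T := by linarith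
      rw [div_le_iff₀ hε] at this
      linarith
    nlinarith
  have hhalf2 : L * (a' + 2 * k + 1 + 1) * (T * h k) ≤ ε * T / 2 := by
    have h1 : (a' + 2 * k + 1 + 1) * h k < ε' := by
      have := hk; ring_nf at this ⊢; exact this
    have h2 : L * ε' ≤ ε / 2 := by
      rw [hε']
      have : L / (L + 1) ≤ 1 := (div_le_one (by linarith)).2 (by linarith)
      calc L * (ε / (2 * (L + 1))) = (ε / 2) * (L / (L + 1)) := by field_simp
        _ ≤ (ε / 2) * 1 := mul_le_mul_of_nonneg_left this (by positivity)
        _ = ε / 2 := mul_one _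
    calc L * (a' + 2 * k + 1 + 1) * (T * h k) = T * (L * ((a' + 2 * k + 1 + 1) * h k)) := by ring
      _ ≤ T * (L * ε') := mul_le_mul_of_nonneg_left (mul_le_mul_of_nonneg_left h1.le hL0) hT0.le
      _ ≤ T * (ε / 2) := mul_le_mul_of_nonneg_left h2 hT0.le
      _ = ε * T / 2 := by ring
  calc ∫ s in s₁..s₁ + T, ∫ y, Real.smoothTransition (a' + 1 - √(1 + ‖y‖ ^ 2)) * (γlo * (w s y - wstar) ^ 2)
      ≤ ∫ s in s₁..s₁ + T, ∫ y, Real.smoothTransition (a' + 2 * k + 1 + 1 - √(1 + ‖y‖ ^ 2)) * (γlo * (w s y - wstar) ^ 2) := hmono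
    _ ≤ (a' + 2 * k + 1 + 1) * B + L * (a' + 2 * k + 1 + 1) * (T * h k) := hwle
    _ ≤ ε * T := by linarith

end Summit.NavierStokesRegularity.NavierStokesRegularity.Theorems.PoloidalWindowDoorPoloidalWindowRigidityZShockLocalizedRelaxation

end
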